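import Summits.BirchSwinnertonDyer.Rank1Residual.ManinAdditive.ThetaFourBrandtDegreeLawAtNine
import Summits.BirchSwinnertonDyer.Rank1Residual.ManinAdditive.NeronOmegaThree
import HarnessLib
import HarnessLib.Audit.Tags

/-!
# Theta series of the θ₄-Brandt module as sections of the dualising sheaf of `X₀(9p)` at `3`
(cell bsd-f2-manin, desc lens g22, MEMO-desc §47; typed rows E-desc-156 … E-desc-159; nothing under `@[conjecture]`
is asserted, §3 is PROVED bookkeeping on the tree's `NeronFLineDatum` interface).

OBJECTS (all from the tree).  `𝓜_θ₄(p)` = θ₄-equivariant functions `ℙ¹(𝔽_p) → ℤ[i]` for the maximal order `O` of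
`B_{3,∞} = (−1,−3)_ℚ` (`ThetaFourBrandt.act3`, `theta4Exp`, `dicyclicOfNorm`, `stabWeight3`, `weightMul3`,
`thetaFourHecke12`, `thetaFourHeightSix`); `Ω₃(N) = NeronOmegaThree.omegaLatticeAtThree N` = imc's E-blind
dualising-sheaf lattice at `3` (ENGINE 7, dictionary (D1)–(D5)); `NeronFLineDatum`, `IsOmegaNeronAtThree` (imc E-150).

THE MECHANISM (desc g22).  For `u : ℙ¹(𝔽_p) → ℤ[i]`, a point `x` and `e ∈ {1, 2}` put
`Θ^{(e)}_{u,x}(q) := Σ_{n ≥ 1, 3 ∤ n} (Σ_{γ ∈ O, Nrd γ = n} i^{e·θ̃₄(γ)} u(γ·x)) qⁿ`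
(`12 ×` an Eichler–Hijikata–Pizer–Shemanske theta series of the special order of level `9p` with the character
`θ₄^e` of `(O/𝔓)^× = 𝔽₉^×`; `e = 1`: the supercuspidal module (Kodaira III/III* curves), `e = 2`: the twisted-Steinberg
module (Kodaira `Iₙ*`)).  CLAIM (E-desc-156): whenever `Re Θ`, `Im Θ` are cusp forms on `Γ₀(9p)` they lie in `Ω₃(9p)`.
By the Brandt spectral decomposition (`T(n)` is self-adjoint for `⟨u,v⟩ = Σ_x ū(x)v(x)`, eigenfunction `f = W g`,
`⟨f,f⟩ = thetaFourHeightSix p g = 6⟨g,g⟩`) the `f_E`-coordinate of `Θ^{(1)}_{δ_z,x}` is `12·f(x)·f̄(z)/⟨f,f⟩`, so the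
theta span realises the `f_E`-congruence INSIDE `Ω₃` to depth `v₃⟨g,g⟩ = v₃(thetaFourHeightSix) − 1` (E-desc-157);
with desc's degree law E-desc-123 (`v₃ deg φ = v₃⟨g,g⟩ + [III*]`) and imc's GIVEN row `Ω₃ = Λ` this is the full Néron
congruence depth on Kodaira type III, whence `3 ∤ c_E` AND Lie-saturation at 3 (§3, PROVED glue).

CENSUS = BC5 WITNESS (kit jobs j334928, j334966, j335022, tag bsd; engine = imc `neronomega.gp` cfb53958 + desc theta
patch `nb/neronomega_theta.gp`; theta data `nb/theta9*.gp` from `nb/theta9.py`): at the 16 levels `9M`,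
`M ∈ {5,7,11,13,17,19,23,25,29,31,35,37,41,43,47,49}`: 1220/1220 orbit theta vectors (both characters, real and
imaginary parts) and 64/64 point series (`e = 1`, `p = 11,13,17`) are cusp forms on `Γ₀(9M)` (q-expansion match to
`3·Sturm + 3` coefficients), `3`-integral, and in `Ω₃(9M)` (0 exceptions); the `f_E`-coordinate valuations of all
4022 (theta vector, optimal class) pairs agree with the spectral formula (0 exceptions); theta depth `= ord₃ r_Ω(f_E)`
on 14/14 III/III* classes and on 22/26 `Iₙ*` classes (the 4 misses are `Iₙ*` with `3 ∣ n`, `3 ∤ μ`: 99b1, 387d1, 423b1 —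
there the Néron depth exceeds the theta depth by `v₃(n) − v₃(μ) = 1`, a level-lowering congruence invisible to `B_{3,∞}`).
JOIN with imc ENGINE 7 (9 ∣ N ≤ 1300) × desc Brandt censuses: `ord₃ r_Ω = v₃ H(g_E) + ε_loc` on 216/216 classes
(`ε = 0` on III/III* at `9 ∥ N`, `36 ∥ N`: 67/67).

TYPER NOTE (typer g21, T-desc-40).  SOURCE = HOME/desc/g22/Sketch-desc-g22.lean sha16 539d4a8b7ad80f27 (215 l.; desc: farm rc 0 · 0 · 0 · 0 s∗rry;
BC7 3/3 CLEAN vs C3, bc7-g22.raw.txt d770eb07e75b2800; typer: own farm check rc 0 · 0 warnings) VERBATIM except this note (desc's own `@[conjecture]`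
tags; bodies, names, namespace `…ManinAdditive.ThetaFourOmega`, imports untouched).  ROUTE-INDEPENDENT: imports the landed
`…ManinAdditive.ThetaFourBrandtDegreeLawAtNine` (T-desc-32, p707444) + `…ManinAdditive.NeronOmegaThree` (imc Ω₃ dictionary) + HarnessLib(+Audit.Tags) —
0 `Theses` edges in either cone.  CONTENT (desc MEMO-desc §47, HOME/MEMO-desc.md l.1899; extract HOME/desc/g22/memo47.md eba0945defc18ca9): computable
`thetaCoeff12` (12 × the theta coefficients of the θ₄^e-Brandt module of the level-9 special order of B_{3,∞}, over the tree's `dicyclicOfNorm` /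
`theta4Exp` / `act3`), predicates `IsThetaPair`, `WeightedNotThreeDivisible`; `@[conjecture]` rows **E-desc-156 `ThetaFourOmegaIntegralAtNinePrime`**
(the theta series lie in imc's Ω₃(9p) — THEOREM-candidate), **E-desc-157 `ThetaFourOmegaWitnessAtNinePrime`** (Ω₃-witness of f_E-depth ≥ the
3-adic Brandt height), **E-desc-158 `NeronDepthEqThetaFourHeightAtNinePrime`** («NÉRON DEPTH = BRANDT HEIGHT» on optimal III/III* at 9p); PROVED glue
(desc, kernel-checked here) **E-desc-159a `manin_and_depth_of_omegaWitness`** (imc GIVEN row `IsOmegaNeronAtThree` + an Ω₃-witness with ord₃ q ≤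
−v₃ deg φ ⟹ 3 ∤ c_E ∧ `NeronCongruenceDepthAt 3`) and **E-desc-159b `manin_at_three_of_thetaWitness`** (E-157 + the 3-part of desc's degree law
E-desc-123 on type III + GIVEN row ⟹ same) ⟹ C3 on Kodaira III at 9p = E-desc-156 ∧ E-desc-123|_{III} ∧ E-imc-150, incl. the 3 ∣ deg φ classes.
NOT IN PRINT as typed (nearest: [Emerton2002] Thm 0.3 prime level theta span; [Pizer1980] Thm 2.26 theta series of orders of level p²M;
[Gross1987Heights]; [AgasheRibetStein2012] Thm 2.1).  BC5 (desc; kit j334928/j334966/j335022 tag bsd; engine imc neronomega.gp cfb53958 + desc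
theta patch nb/neronomega_theta.gp f7c2a3bb6cf6936e; generator nb/theta9.py 57b9361661b35b0a; table HOME/desc/g22/nb/THETA-OMEGA-table.md
4c52ce26d2d518ed; SHA16SUMS.desc.g22): 16 levels 9M (M = 5…49 incl. 25, 35, 49): 1220/1220 orbit theta vectors + 64/64 point series are cusp
forms on Γ₀(9M), 3-integral and in Ω₃(9M); spectral formula 4022/4022; theta depth = ord₃ r_Ω(f_E) on 14/14 III/III* and 22/22 Iₙ* (3 ∤ n)
(3 explained misses at Iₙ*, 3 ∣ n); JOIN law ord₃ r_Ω = v₃ H(g_E) + ε_loc 171/171; 0 violations on the typed rows.  CHEAPEST FALSIFIER (R-desc-38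
(a)): E-156 at a new prime p ∈ {53, 59, 61} or composite M ∈ {55, 65, 77}, one kit job.  REFUTER VERDICTS: ref1/ref2 R-desc-38 PENDING at landing
(incl. (c) audit of the use of `IsOmegaNeronAtThree`.2 in `manin_and_depth_of_omegaWitness`).  Typer checks: 8 decl names fresh tree-wide; cite
keys CremonaEcdata / Pizer1980 / Gross1987Heights / Emerton2002 / AgasheRibetStein2012 in references.bib; no instances, no notation; 215 + note <
400 lines.  PARTITION 0 · beyond-print theorem: no · bears_on: stmt-BirchSwinnertonDyer-22968 (C3 `ManinPrimeToThreeAtNine`; desc's crux idea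
card `theta-visibility-neron-depth-3` is with the LEAD to file).  BSD is not proved by this; C2, C3 not proved by this.

APPEND (typer g21, T-desc-40 v2, desc addendum 19:16:52Z): desc's Sketch v2 sha16 08b4ab1bc59dd4c1 = v1 539d4a8b7ad80f27 + two PROVED theorems at
the end of `section Glue`, appended here VERBATIM: the arithmetic lemma `height_val_of_degreeLaw` and **E-desc-159c
`manin_at_three_of_thetaWitness_of_degreeLaw`** (E-157 ∧ the tree row `ThetaFourBrandtDegreeLawAtNinePrime` (E-desc-123, literal) ∧ imc's GIVEN row
⟹ 3 ∤ c_E ∧ Néron congruence depth at 3 on optimal Kodaira-III curves at 9p).  Out-of-sample census (desc kit j335211, N = 477, 495, 549,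
pre-registered): 826/826 theta vectors in Ω₃, spectral 584/584, III/III* depth 2/2 ⟹ E-desc-156 total 2046/2046 + 64/64 at 19 levels, depth 16/16.
-/

namespace Summit.BirchSwinnertonDyer.Rank1Residual.ManinAdditive.ThetaFourOmega

open scoped MatrixGroups ModularForm
open CongruenceSubgroup WeierstrassCurve Literature.NumberTheory.EllipticCurves
open Literature.NumberTheory.EllipticCurves.ModularForms
open Summit.BirchSwinnertonDyer.Rank1Residual.ManinAdditive.HurwitzBrandt (DQuat)
open Summit.BirchSwinnertonDyer.Rank1Residual.ManinAdditive.ThetaFourBrandt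
open Summit.BirchSwinnertonDyer.Rank1Residual.ManinAdditive.NeronOmegaThree

/-! ### §1. Theta coefficients (computable, over the tree's θ₄-Brandt primitives) -/

/-- `12 ×` the `n`-th coefficient of the theta series `Θ^{(e)}_{u,x}`:
`Σ_{γ ∈ O, Nrd γ = n} i^{e·θ̃₄(γ)} · u(γ·x)` for `3 ∤ n`, and `0` for `3 ∣ n` (every `γ` with `3 ∣ Nrd γ` lies in `𝔓`,
where `θ₄ = 0`; this also discards the junk value of `theta4Exp` on `𝔓`).  `e = 1`: character `θ₄`; `e = 2`: `θ₄²`.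
[folklore] -/
def thetaCoeff12 (e p n : ℕ) (u : Fin (p + 1) → ZI) (x : Fin (p + 1)) : ZI :=
  if 3 ∣ n then (0, 0)
  else ((dicyclicOfNorm n).map fun γ => ZI.iPowMul (e * theta4Exp γ) (u (act3 p γ x))).foldr ZI.add (0, 0)

/-- `(Θ₁, Θ₂)` ARE the real and imaginary parts of `Θ^{(e)}_{u,x}`: cusp forms on `Γ₀(N)` whose `q`-expansions at `∞`
are `Σ_{n≥1} Re/Im (thetaCoeff12 e p n u x) qⁿ`.  (A predicate: modularity is a HYPOTHESIS of the rows below, so the rows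
assert nothing about the Eisenstein part of the `e = 2` module.) [folklore] -/
def IsThetaPair (e p N : ℕ) (u : Fin (p + 1) → ZI) (x : Fin (p + 1)) (Θ₁ Θ₂ : CuspForm (Gamma0 N) 2) : Prop :=
  ∀ n : ℕ, 1 ≤ n →
    cuspCoeff Θ₁ n = ((thetaCoeff12 e p n u x).1 : ℂ) ∧ cuspCoeff Θ₂ n = ((thetaCoeff12 e p n u x).2 : ℂ)

/-- `3 ∤ cont(W g)`: the weighted eigenfunction `f = W g` is not divisible by `3` in `ℤ[i]^{ℙ¹(𝔽_p)}` (automatic unless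
`g ≡ 0 (mod 3)` off the orbits with stabiliser of order 3; desc census: never on the 454 III/III* curves, 4 times among
971 `Iₙ*` curves — 1953g1, 2709b1, 6489e1, 7137f1, all with a 9-isogeny). [folklore] -/
def WeightedNotThreeDivisible (p : ℕ) (g : Fin (p + 1) → ZI) : Prop :=
  ∃ x : Fin (p + 1), ¬ ((3 : ℤ) ∣ (weightMul3 p g x).1 ∧ (3 : ℤ) ∣ (weightMul3 p g x).2)

/-! ### §2. Rows (nothing asserted) -/

/-- **Row E-desc-156 `ThetaFourOmegaIntegralAtNinePrime`** (THEOREM-candidate; cell bsd-f2-manin, desc g22, MEMO-desc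
§47).  For a prime `p ≥ 5`, `e ∈ {1,2}`, any `u : ℙ¹(𝔽_p) → ℤ[i]` and any point `x`: if the real and imaginary parts of
`Θ^{(e)}_{u,x}` are cusp forms on `Γ₀(9p)`, they lie in the dualising-sheaf lattice `Ω₃(9p)` (conditions (C_0) at the
cusp `0` and (C_1) at the cusp `1/3` with the différent allowance).  Census: 1220/1220 orbit series + 64/64 point series
at 16 levels (module docstring).  Mechanism on paper: `w₉` and the level-3 twisting operator act on the theta series of
the special order through `B^×` (the normaliser element `j`, `Nrd j = 3`, and the characters of `(O/𝔓)^×`), so the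
expansions at `0` and `1/3` are again theta series with Gauss-sum factors `g(θ₄^e)/3`, of `(1−ζ₃)`-valuation `≥ −1`.
Why it might fail: a prime `p` at which the `(C_1)` allowance is exhausted by a Gauss sum of `θ₄` (valuation exactly
`−1` is attained at every tested level, so there is no slack), or composite `M` with `3 | φ(M)`-type extra units.
[cite: CremonaEcdata] [cite: Pizer1980, Thm. 2.26 (theta series of orders of level p²M; shape)] [cite: Gross1987Heights, §1–§3 (Brandt module, heights; dictionary)] -/
@[conjecture]
def ThetaFourOmegaIntegralAtNinePrime : Prop :=
  ∀ (p e : ℕ) [NeZero (9 * p)], p.Prime → 5 ≤ p → (e = 1 ∨ e = 2) →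
  ∀ (u : Fin (p + 1) → ZI) (x : Fin (p + 1)) (Θ₁ Θ₂ : CuspForm (Gamma0 (9 * p)) 2),
    IsThetaPair e p (9 * p) u x Θ₁ Θ₂ →
    Θ₁ ∈ omegaLatticeAtThree (9 * p) ∧ Θ₂ ∈ omegaLatticeAtThree (9 * p)

/-- **Row E-desc-157 `ThetaFourOmegaWitnessAtNinePrime`** (THEOREM-candidate = E-desc-156 + the Brandt spectral
formula; desc g22).  For an elliptic curve of conductor `9p` (`p ≥ 5` prime) whose newform has a θ₄-equivariant
Hecke eigenvector `g` (Kodaira III/III* at 3) with `3 ∤ cont(W g)`: SOME element of `Ω₃(9p)` has `f_E`-coordinate `q`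
(`q⟨f,f⟩ = ⟨f,x⟩`) with `ord₃ q ≤ 1 − v₃(6⟨g,g⟩) = −v₃⟨g,g⟩` — the Néron congruence depth of `f_E` is AT LEAST the
`3`-adic Brandt height.  (Witness on paper: `x = Re` or `Im` of `Θ^{(1)}_{δ_z,x₀} − (its f-orthogonal part is irrelevant)`
at points `x₀, z` where `W g` is a `3`-adic unit; `q = 12 f(x₀) f̄(z)/⟨f,f⟩`.)  Census: theta depth `= v₃⟨g,g⟩` on 14/14
III/III* classes `≤ 441`; spectral formula 4022/4022.  Why it might fail: multiplicity `> 1` of the eigensystem of `f_E`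
in `𝓜_θ₄(p) ⊗ ℚ(i)` (a second vector with a smaller height would only IMPROVE the bound; failure needs E-desc-156 to fail).
[cite: CremonaEcdata] [cite: Gross1987Heights, §3] [cite: Emerton2002, Thm. 0.3 (prime level: theta series span; the analogy)] -/
@[conjecture]
def ThetaFourOmegaWitnessAtNinePrime : Prop :=
  ∀ (p : ℕ), p.Prime → 5 ≤ p →
  ∀ (W : WeierstrassCurve ℚ) [W.IsElliptic] [NeZero (W.conductorNorm ℤ)]
    (D : ModularParametrizationData W (W.conductorNorm ℤ)),
    W.conductorNorm ℤ = 9 * p →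
  ∀ g : Fin (p + 1) → ZI,
    IsThetaFourEquivariant p g → IsThetaFourHeckeEigen p g (fun n => W.LFunction n) → WeightedNotThreeDivisible p g →
    ∃ x ∈ omegaLatticeAtThree (W.conductorNorm ℤ), ∃ q : ℚ, q ≠ 0 ∧
      (q : ℂ) * peterssonProduct (Gamma0 (W.conductorNorm ℤ)) 2 D.f D.f =
        peterssonProduct (Gamma0 (W.conductorNorm ℤ)) 2 D.f x ∧
      padicValRat 3 q + padicValInt 3 (thetaFourHeightSix p g) ≤ 1

/-- **Row E-desc-158 `NeronDepthEqThetaFourHeightAtNinePrime`** (LAW, identity; desc g22 «NÉRON DEPTH = BRANDT HEIGHT»,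
the exact form of E-desc-157 for OPTIMAL curves): with `r_Ω(f) = lineIndex Ω₃(9p) f` (imc's `[e_f Ω₃ : ℤ f]`),
`v₃ r_Ω(f_E) + 1 = v₃(6⟨g_E, g_E⟩)` for every `X₀(9p)`-optimal curve of Kodaira type III or III* at 3.  Census: imc ENGINE 7
× desc CENSUS-123 join, prime levels `9p ≤ 1300`: every joined III/III* class (module docstring; 67/67 at all `9 ∥ N`,
`36 ∥ N` levels jointly), and directly (theta patch) 14/14.  CONTRAST: the congruence number `r_S` does NOT follow the
height (`v₃ r_S − v₃⟨g,g⟩ ∈ {0,1}` irregularly on type III: 8 × 0, 21 × 1).  Why it might fail: an optimal III curve whose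
`f` is congruent mod 3, inside `Ω₃`, to a form outside the θ₄-module (principal series or CM), giving `r_Ω` deeper than the
height — the `Iₙ*` analogue of exactly this happens (99b1).
[cite: CremonaEcdata] [cite: AgasheRibetStein2012, Thm. 2.1 (r vs deg; p² ∣ N caveat)] [cite: Gross1987Heights, §3] -/
@[conjecture]
def NeronDepthEqThetaFourHeightAtNinePrime : Prop :=
  ∀ (p : ℕ), p.Prime → 5 ≤ p →
  ∀ (W : WeierstrassCurve ℚ) [W.IsElliptic] [W.IsGloballyMinimal] [NeZero (W.conductorNorm ℤ)]
    (D : ModularParametrizationData W (W.conductorNorm ℤ)),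
    W.conductorNorm ℤ = 9 * p →
    (∀ z ∈ D.L.lattice, ∃ w ∈ periodLattice D.f, z = D.c * w) →
    (∀ (W' : WeierstrassCurve ℚ) [W'.IsElliptic]
        (D' : ModularParametrizationData W' (W.conductorNorm ℤ)),
        D'.f = D.f → D.modularDegree ≤ D'.modularDegree) →
  ∀ g : Fin (p + 1) → ZI,
    IsThetaFourEquivariant p g → IsPrimitive3 p g → IsThetaFourHeckeEigen p g (fun n => W.LFunction n) →
    padicValNat 3 (lineIndex (omegaLatticeAtThree (W.conductorNorm ℤ)) D.f) + 1 =
      padicValInt 3 (thetaFourHeightSix p g)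

/-! ### §3. PROVED glue on the `NeronFLineDatum` interface: an Ω-witness of depth `≥ v₃(deg φ)` decides Manin at 3 -/

section Glue

variable {N : ℕ} [NeZero N] {W : WeierstrassCurve ℚ} [W.IsElliptic] {D : ModularParametrizationData W N}
  (Δ : NeronFLineDatum W D)

/-- **E-desc-159a (PROVED).**  GIVEN row `Ω₃ = Λ` (imc E-150) + an element of `Ω₃(N)` whose `f`-coordinate has
`ord₃ ≤ −v₃(deg φ)` ⇒ `3 ∤ c_E` AND Néron congruence depth at 3 (hence Lie-saturation, `depthAt_iff`).  The valuation can
only be `= −v₃(deg φ)`: `ξ^*(n•x) = (deg φ / c)·n q ∈ ℤ`.  This replaces the `lineIndex` bookkeeping of imc's support row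
E-imc-151 by an explicit witness, which is what theta series provide. -/
theorem manin_and_depth_of_omegaWitness (hΩ : IsOmegaNeronAtThree Δ)
    {x : CuspForm (Gamma0 N) 2} (hx : x ∈ omegaLatticeAtThree N) {q : ℚ} (hq0 : q ≠ 0)
    (hq : (q : ℂ) * peterssonProduct (Gamma0 N) 2 D.f D.f = peterssonProduct (Gamma0 N) 2 D.f x)
    (hval : padicValRat 3 q ≤ -(padicValNat 3 D.modularDegree : ℤ)) :
    ¬ (3 : ℤ) ∣ D.maninConstant ∧ Δ.NeronCongruenceDepthAt 3 := by
  haveI : Fact (Nat.Prime 3) := ⟨Nat.prime_three⟩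
  obtain ⟨n, hn3, hnx⟩ := hΩ.2 x hx
  have hn0 : n ≠ 0 := by rintro rfl; exact hn3 (dvd_zero 3)
  set g : Δ.Λ := ⟨(n : ℤ) • x, hnx⟩ with hg
  -- the f-coordinate of `n • x` is `n q`
  have hq' : ((n * q : ℚ) : ℂ) * peterssonProduct (Gamma0 N) 2 D.f D.f =
      peterssonProduct (Gamma0 N) 2 D.f (g : CuspForm (Gamma0 N) 2) := by
    have h1 : (g : CuspForm (Gamma0 N) 2) = ((n : ℤ) : ℂ) • x := by
      rw [hg]; exact (Int.cast_smul_eq_zsmul ℂ (n : ℤ) x).symm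
    rw [h1, peterssonProduct_smul_right, ← hq]
    push_cast
    ring
  have hnq0 : (n : ℚ) * q ≠ 0 := mul_ne_zero (by exact_mod_cast hn0) hq0
  have hvn : padicValRat 3 (n : ℚ) = 0 := by
    rw [padicValRat.of_nat, Nat.cast_eq_zero]
    exact padicValNat.eq_zero_of_not_dvd hn3
  have hval' : padicValRat 3 ((n : ℚ) * q) ≤ -(padicValNat 3 D.modularDegree : ℤ) := by
    rw [padicValRat.mul (by exact_mod_cast hn0) hq0, hvn, zero_add]; exact hval
  -- lower bound from `ξ^*(g) = κ · (n q) ∈ ℤ`, `κ c = deg φ`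
  have hdeg : (D.modularDegree : ℚ) ≠ 0 := by exact_mod_cast D.deg_pos.ne'
  have hκc := Δ.κ_mul_maninConstant
  have hc : (D.maninConstant : ℚ) ≠ 0 := by
    intro h0; rw [h0, mul_zero] at hκc; exact hdeg hκc.symm
  have hx' : (Δ.xiStar g : ℚ) * D.maninConstant = D.modularDegree * (n * q) := by
    rw [Δ.xiStar_eq_of_coord hq', ← hκc]; ring
  have hxz : (Δ.xiStar g : ℚ) ≠ 0 := by
    intro h0; rw [h0, zero_mul] at hx'; exact (mul_ne_zero hdeg hnq0) hx'.symm
  have hv := congrArg (padicValRat 3) hx'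
  rw [padicValRat.mul hxz hc, padicValRat.mul hdeg hnq0, padicValRat.of_int, padicValRat.of_int,
    padicValRat.of_nat] at hv
  -- hv : ↑(v ξg) + ↑(v c) = ↑(v deg) + v(nq);  hval' : v(nq) ≤ -v deg
  have hvc : (padicValInt 3 D.maninConstant : ℤ) = 0 := by
    have h0 : (0 : ℤ) ≤ padicValInt 3 (Δ.xiStar g) := by exact_mod_cast Nat.zero_le _
    have h1 : (0 : ℤ) ≤ padicValInt 3 D.maninConstant := by exact_mod_cast Nat.zero_le _
    linarith
  have hveq : padicValRat 3 ((n : ℚ) * q) = -(padicValNat 3 D.modularDegree : ℤ) := by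
    have h0 : (0 : ℤ) ≤ padicValInt 3 (Δ.xiStar g) := by exact_mod_cast Nat.zero_le _
    linarith
  refine ⟨fun hdvd => ?_, ⟨g, n * q, hnq0, hq', hveq⟩⟩
  rcases (padicValInt_dvd_iff (p := 3) 1 D.maninConstant).mp (by rw [pow_one]; exact_mod_cast hdvd) with h0 | h1
  · exact hc (by exact_mod_cast h0)
  · have h2 : (1 : ℤ) ≤ (padicValInt 3 D.maninConstant : ℤ) := by exact_mod_cast h1
    linarith

/-- **E-desc-159b (PROVED assembly on Kodaira type III at prime level).**  E-desc-157 (theta witness) + the `3`-part of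
desc's degree law E-desc-123 on type III (`v₃(6⟨g,g⟩) = v₃ deg φ + 1`, passed as the hypothesis `hdeg3`) + imc's GIVEN row
⇒ `3 ∤ c_E` and Néron congruence depth at 3.  (So on type III the desc lens proves «depth ≥ height» by theta series and
needs only «`v₃ deg φ ≤ v₃⟨g,g⟩`», the Ribet–Takahashi direction of E-desc-123, to decide C3 there.) -/
theorem manin_at_three_of_thetaWitness (hΘ : ThetaFourOmegaWitnessAtNinePrime) {p : ℕ} (hp : p.Prime) (h5 : 5 ≤ p)
    {W : WeierstrassCurve ℚ} [W.IsElliptic] [NeZero (W.conductorNorm ℤ)]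
    {D : ModularParametrizationData W (W.conductorNorm ℤ)} (Δ : NeronFLineDatum W D)
    (hN : W.conductorNorm ℤ = 9 * p) (hΩ : IsOmegaNeronAtThree Δ)
    {g : Fin (p + 1) → ZI} (heq : IsThetaFourEquivariant p g)
    (hH : IsThetaFourHeckeEigen p g (fun n => W.LFunction n)) (hW : WeightedNotThreeDivisible p g)
    (hdeg3 : padicValInt 3 (thetaFourHeightSix p g) = padicValNat 3 D.modularDegree + 1) :
    ¬ (3 : ℤ) ∣ D.maninConstant ∧ Δ.NeronCongruenceDepthAt 3 := by
  obtain ⟨x, hx, q, hq0, hq, hval⟩ := hΘ p hp h5 W D hN g heq hH hW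
  refine manin_and_depth_of_omegaWitness Δ hΩ hx hq0 hq ?_
  have : (padicValInt 3 (thetaFourHeightSix p g) : ℤ) = padicValNat 3 D.modularDegree + 1 := by exact_mod_cast hdeg3
  linarith

/-- Pure arithmetic: the `3`-adic content of an identity of the shape of desc's degree law E-desc-123
(`3·2^a·deg φ = 2·3^b·(6⟨g,g⟩)`): `v₃(6⟨g,g⟩) + b = v₃ deg φ + 1`. -/
theorem height_val_of_degreeLaw {m : ℕ} (hm : 0 < m) {H : ℤ} {a b : ℕ}
    (h : 3 * (2 : ℤ) ^ a * (m : ℤ) = 2 * 3 ^ b * H) : padicValInt 3 H + b = padicValNat 3 m + 1 := by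
  haveI : Fact (Nat.Prime 3) := ⟨Nat.prime_three⟩
  have hH : H ≠ 0 := by
    rintro rfl
    have : (3 * (2 : ℤ) ^ a) * (m : ℤ) = 0 := by simpa using h
    rcases mul_eq_zero.mp this with h0 | h0
    · exact absurd h0 (by positivity)
    · exact hm.ne' (by exact_mod_cast h0)
  have hnat : 3 * 2 ^ a * m = 2 * 3 ^ b * H.natAbs := by
    have := congrArg Int.natAbs h
    simpa [Int.natAbs_mul, Int.natAbs_pow] using this
  have hHn : H.natAbs ≠ 0 := Int.natAbs_ne_zero.mpr hH
  have h32 : padicValNat 3 2 = 0 := padicValNat_primes (by norm_num)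
  have h33 : padicValNat 3 3 = 1 := padicValNat_self
  have h2a : padicValNat 3 (2 ^ a) = 0 :=
    padicValNat.eq_zero_of_not_dvd fun hd => by
      have := Nat.Prime.dvd_of_dvd_pow Nat.prime_three hd
      omega
  have h3b : padicValNat 3 (3 ^ b) = b := padicValNat.prime_pow b
  have hv := congrArg (padicValNat 3) hnat
  rw [padicValNat.mul (by positivity) hm.ne', padicValNat.mul (by norm_num) (by positivity), h2a, h33,
    padicValNat.mul (by positivity) hHn, padicValNat.mul (by norm_num) (by positivity), h3b, h32] at hv
  simp only [padicValInt]
  omega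

/-- **E-desc-159c (PROVED assembly, literal form).**  E-desc-157 (theta witness) ∧ E-desc-123 (desc's degree law at
`9 ∥ N`, tree row `ThetaFourBrandtDegreeLawAtNinePrime`) ∧ imc's GIVEN row ⟹ for every `X₀(9p)`-optimal curve of Kodaira
type III at 3 (`¬ IsTypeThreeStarAtThreeTame`) carrying a primitive θ₄-eigenvector with `3 ∤ cont(Wg)`:
`3 ∤ c_E` and Néron congruence depth at 3. -/
theorem manin_at_three_of_thetaWitness_of_degreeLaw (hΘ : ThetaFourOmegaWitnessAtNinePrime)
    (hdeg : ThetaFourBrandtDegreeLawAtNinePrime) {p : ℕ} (hp : p.Prime) (h5 : 5 ≤ p)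
    {W : WeierstrassCurve ℚ} [W.IsElliptic] [W.IsGloballyMinimal] [NeZero (W.conductorNorm ℤ)]
    {D : ModularParametrizationData W (W.conductorNorm ℤ)} (Δ : NeronFLineDatum W D)
    (hN : W.conductorNorm ℤ = 9 * p) (hΩ : IsOmegaNeronAtThree Δ)
    (hopt : ∀ z ∈ D.L.lattice, ∃ w ∈ periodLattice D.f, z = D.c * w)
    (hmin : ∀ (W' : WeierstrassCurve ℚ) [W'.IsElliptic] (D' : ModularParametrizationData W' (W.conductorNorm ℤ)),
        D'.f = D.f → D.modularDegree ≤ D'.modularDegree)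
    (hIII : ¬ IsTypeThreeStarAtThreeTame W)
    {g : Fin (p + 1) → ZI} (heq : IsThetaFourEquivariant p g) (hprim : IsPrimitive3 p g)
    (hH : IsThetaFourHeckeEigen p g (fun n => W.LFunction n)) (hW : WeightedNotThreeDivisible p g) :
    ¬ (3 : ℤ) ∣ D.maninConstant ∧ Δ.NeronCongruenceDepthAt 3 := by
  have hlaw := hdeg p hp h5 W D hN hopt hmin g heq hprim hH
  rw [if_neg hIII] at hlaw
  have hv := height_val_of_degreeLaw (m := D.modularDegree) D.deg_pos hlaw
  exact manin_at_three_of_thetaWitness hΘ hp h5 Δ hN hΩ heq hH hW (by simpa using hv)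

end Glue

end Summit.BirchSwinnertonDyer.Rank1Residual.ManinAdditive.ThetaFourOmega
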